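import Summits.Ventures.PercRepro.ProfileMixedStep

/-!
# PercRepro — `MAS` restricted to rank-`q` antichains is night-3's Hall form `H⁺` (p10, gen 0; S5 §2.4 Remark (3))

On a rank-`q` set `B` with `q < u` the mixed-antichain price `Skew.pi M u B = cpr q ρ(E∖B) u` is night-3's profile
price `Profile.price M q u B` (`pi_eq_price`), so `MAS M u` implies the Hall inequality of `ProfileHall` for every
ANTICHAIN `𝒜 ⊆ Profile.Rq M q` (`profileHall_antichain_of_mas`), and in particular the profile inequality
`(Π_{q,u})` restricted to the independent `q`-sets (`profileIneq_indep_of_mas`, the minimal rank-`q` sets — an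
antichain whose shadow is the whole level).  Neither `H⁺` (which allows comparable rank-`q` members) nor `(Π_{q,u})`
(all rank-`q` sets) is claimed; this file only fixes the dictionary between the two vocabularies.
-/

open scoped Matroid

namespace PercRepro.Skew

open Finset ThmH Shadow Profile

variable {α : Type} [DecidableEq α] {M : Matroid α} [M.Finite]

/-- On a rank-`q` set and a level `u > q`, the mixed-antichain price is the profile price. -/
theorem pi_eq_price {q u : ℕ} (hqu : q < u) {B : Finset α} (hB : B ∈ Rq M q) :
    pi M u B = price M q u B := by
  have hq : rk M B = q := by
    unfold rk; rw [(mem_Rq.1 hB).2, ENat.toNat_coe]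
  unfold pi price
  rw [hq]
  by_cases h : (u : ℕ∞) ≤ M.eRk ((gr M \ B : Finset α) : Set α)
  · rw [if_pos h]
    have hp : u ≤ rk M (gr M \ B) := by
      have := h
      rw [← coe_rk] at this
      exact_mod_cast this
    rw [cpr_of_lt_of_le hqu hp]
    unfold rk
    rw [Nat.add_comm]
  · rw [if_neg h]
    have hp : rk M (gr M \ B) < u := by
      rw [not_le, ← coe_rk] at h
      exact_mod_cast h
    exact cpr_of_lt_of_gt hqu hp

/-- `MAS M u` gives the Hall inequality of `ProfileHall` on every antichain of rank-`q` sets, `q < u`. -/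
theorem profileHall_antichain_of_mas {u : ℕ} (h : MAS M u) (q : ℕ) (hqu : q < u) (𝒜 : Finset (Finset α))
    (h𝒜 : 𝒜 ⊆ Rq M q) (hanti : ∀ B ∈ 𝒜, ∀ B' ∈ 𝒜, B ⊆ B' → B = B') :
    ∑ B ∈ 𝒜, price M q u B ≤ ((shadowLevel M u 𝒜).card : ℚ) := by
  have h1 := h 𝒜 (fun B hB => (mem_Rq.1 (h𝒜 hB)).1) hanti
  rwa [Finset.sum_congr rfl (fun B hB => pi_eq_price hqu (h𝒜 hB))] at h1

/-- The independent `q`-sets: the minimal rank-`q` sets. -/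
noncomputable def indepSets (M : Matroid α) [M.Finite] (q : ℕ) : Finset (Finset α) :=
  (Rq M q).filter (fun B => B.card = q)

omit [DecidableEq α] in
/-- An independent `q`-set is a rank-`q` set of size `q`. -/
theorem mem_indepSets {q : ℕ} {B : Finset α} : B ∈ indepSets M q ↔ B ∈ Rq M q ∧ B.card = q := by
  unfold indepSets; rw [Finset.mem_filter]

omit [DecidableEq α] in
/-- The independent `q`-sets form an antichain. -/
theorem indepSets_antichain (q : ℕ) : ∀ B ∈ indepSets M q, ∀ B' ∈ indepSets M q, B ⊆ B' → B = B' := by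
  intro B hB B' hB' hBB'
  rw [mem_indepSets] at hB hB'
  exact Finset.eq_of_subset_of_card_le hBB' (by rw [hB.2, hB'.2])

/-- `MAS M u` gives `(Π_{q,u})` with the sum restricted to the independent `q`-sets (`q < u`). -/
theorem profileIneq_indep_of_mas {u : ℕ} (h : MAS M u) (q : ℕ) (hqu : q < u) :
    ∑ B ∈ indepSets M q, price M q u B ≤ ((levelSet M u).card : ℚ) := by
  calc ∑ B ∈ indepSets M q, price M q u B
      ≤ ((shadowLevel M u (indepSets M q)).card : ℚ) :=
        profileHall_antichain_of_mas h q hqu _ (Finset.filter_subset _ _) (indepSets_antichain q)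
    _ ≤ ((levelSet M u).card : ℚ) := by
        exact_mod_cast Finset.card_le_card (Finset.filter_subset _ _)

end PercRepro.Skew
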